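import Summits.ValiantsHypothesis.ValiantsHypothesis.Theorems.SymPencilSdcPerFourCellNineSevenSplit

/-!
# Route `SymPencil` — inner rank of the `2|2` split of `per_4` on hyperplanes: the `u`-restricted
# form (first file of the IR9H programme; `--supports` stmt-ValiantsHypothesis-5674
# `SdcSuperquadratic`; rung currency only — nothing here bears on `VP ≠ VNP`)

Cell `(9, 7, 8)` of the size-`27` table is empty given **IR9H**
(`SymPencilSdcPerFourCellNineSevenSplit.false_of_rank_nine_le_twentySeven_of_IR9H`): no `8`-square
bilinear representation `Σ_r c_r t_r(u, y)² = per [u.1; u.2; y.1; y.2]` with `u ∈ K⁴ × K⁴` and `y`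
in a `7`-dimensional `V' ≤ K⁴ × K⁴`.  Since `per [a; b; y₂; y₃] = per [y₂; y₃; a; b]`, the SAME
statement with the restriction moved to the OTHER argument is equivalent:

* **IR9U**: for every `7`-dimensional `U' ≤ K⁴ × K⁴` there are no `c`, `t` with
  `Σ_r c_r t_r(u, (y₂, y₃))² = per [u.1; u.2; y₂; y₃]` for all `u ∈ U'` and ALL `y₂, y₃ ∈ K⁴`.

`IR9H_of_IR9U`, `IR9U_of_IR9H` (flip the bilinear forms), and the cell corollary
`false_of_rank_nine_le_twentySeven_of_IR9U`.  The point of IR9U: the `y`-side linear algebra of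
the landed full-space proof (`SymPencilPerFourInnerRankFamily/Pairs/Nine/Ten`: kernel vectors of
`y ↦ (t_r(u,y))_r`, radical vectors `(k,0)`, `(0,k)`, the pure-case maps onto `K⁶`) lives in the
UNRESTRICTED variable and survives verbatim; only the `u`-side test families
`F_cd = {(a, β e_c + γ e_d)}` are cut to their sections `F_cd ∩ U'` (memo
`HOME(val-lit)/NOTE-port4g2-CELL-NINE-SEVEN.md` §3).

Honest framing: IR9U/IR9H are OPEN; cell `(9,7,8)` closed only conditionally; window
`27 ≤ sdc(per₄) ≤ 29` UNCHANGED; stmt-5674 OPEN; `VP ≠ VNP` not moved; no summit statement is proved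
here.  No definitions, no named facts. [folklore]
-/

noncomputable section

-- single-conjunct layout: Sub = Summit, duplicated namespace component intended
set_option linter.dupNamespace false

namespace Summit.ValiantsHypothesis.ValiantsHypothesis.Theorems.SymPencilPerFourInnerRankNineHyperplane

open Matrix MvPolynomial Module
open Literature.Computability.AlgebraicComplexity
open Summit.ValiantsHypothesis.ValiantsHypothesis.Theorems.SymPencilPerFourInnerRankRows
open Summit.ValiantsHypothesis.ValiantsHypothesis.Theorems.SymPencilSdcPerFourCellNineSevenSplit

universe u

variable {K : Type u} [Field K]

/-- Swapping the two row pairs of `per [a; b; c; d]`. [folklore] -/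
theorem permanent_rows_swap_pairs (a b c d : Fin 4 → K) :
    (Matrix.of ![a, b, c, d]).permanent = (Matrix.of ![c, d, a, b]).permanent := by
  simp only [permanent_of_rows]; ring

/-- **IR9U ⇒ IR9H** (flip the bilinear forms). [folklore] -/
theorem IR9H_of_IR9U
    (IR9U : ∀ U' : Submodule K ((Fin 4 → K) × (Fin 4 → K)), finrank K U' = 7 →
      ∀ (c : Fin 8 → K)
        (t : Fin 8 → (((Fin 4 → K) × (Fin 4 → K)) →ₗ[K] ((Fin 4 → K) × (Fin 4 → K)) →ₗ[K] K)),
      ¬ (∀ u ∈ U', ∀ y₂ y₃ : Fin 4 → K,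
          ∑ r, c r * (t r u (y₂, y₃)) ^ 2 = (Matrix.of ![u.1, u.2, y₂, y₃]).permanent)) :
    ∀ V' : Submodule K ((Fin 4 → K) × (Fin 4 → K)), finrank K V' = 7 →
      ∀ (c : Fin 8 → K)
        (t : Fin 8 → (((Fin 4 → K) × (Fin 4 → K)) →ₗ[K] ((Fin 4 → K) × (Fin 4 → K)) →ₗ[K] K)),
      ¬ (∀ a b : Fin 4 → K, ∀ y ∈ V',
          ∑ r, c r * (t r (a, b) y) ^ 2 = (Matrix.of ![a, b, y.1, y.2]).permanent) := by
  intro V' hV c t hJ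
  refine IR9U V' hV c (fun r => (t r).flip) fun u hu y₂ y₃ => ?_
  simp only [LinearMap.flip_apply]
  rw [permanent_rows_swap_pairs]
  exact hJ y₂ y₃ u hu

/-- **IR9H ⇒ IR9U** (the converse flip). [folklore] -/
theorem IR9U_of_IR9H
    (IR9H : ∀ V' : Submodule K ((Fin 4 → K) × (Fin 4 → K)), finrank K V' = 7 →
      ∀ (c : Fin 8 → K)
        (t : Fin 8 → (((Fin 4 → K) × (Fin 4 → K)) →ₗ[K] ((Fin 4 → K) × (Fin 4 → K)) →ₗ[K] K)),
      ¬ (∀ a b : Fin 4 → K, ∀ y ∈ V',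
          ∑ r, c r * (t r (a, b) y) ^ 2 = (Matrix.of ![a, b, y.1, y.2]).permanent)) :
    ∀ U' : Submodule K ((Fin 4 → K) × (Fin 4 → K)), finrank K U' = 7 →
      ∀ (c : Fin 8 → K)
        (t : Fin 8 → (((Fin 4 → K) × (Fin 4 → K)) →ₗ[K] ((Fin 4 → K) × (Fin 4 → K)) →ₗ[K] K)),
      ¬ (∀ u ∈ U', ∀ y₂ y₃ : Fin 4 → K,
          ∑ r, c r * (t r u (y₂, y₃)) ^ 2 = (Matrix.of ![u.1, u.2, y₂, y₃]).permanent) := by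
  intro U' hU c t hJ
  refine IR9H U' hU c (fun r => (t r).flip) fun a b y hy => ?_
  simp only [LinearMap.flip_apply]
  rw [permanent_rows_swap_pairs]
  exact hJ y hy a b

/-- **Cell `(9, 7, 8)` is empty GIVEN IR9U.** [folklore] -/
theorem false_of_rank_nine_le_twentySeven_of_IR9U (K : Type*) [Field K] [CharZero K]
    (IR9U : ∀ U' : Submodule K ((Fin 4 → K) × (Fin 4 → K)), finrank K U' = 7 →
      ∀ (c : Fin 8 → K)
        (t : Fin 8 → (((Fin 4 → K) × (Fin 4 → K)) →ₗ[K] ((Fin 4 → K) × (Fin 4 → K)) →ₗ[K] K)),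
      ¬ (∀ u ∈ U', ∀ y₂ y₃ : Fin 4 → K,
          ∑ r, c r * (t r u (y₂, y₃)) ^ 2 = (Matrix.of ![u.1, u.2, y₂, y₃]).permanent))
    {m : ℕ} (hm : m ≤ 27)
    {i₀ : Fin m} {D : Matrix {i // i ≠ i₀} {i // i ≠ i₀} K}
    {bL : (Fin 4 × Fin 4 → K) →ₗ[K] ({i // i ≠ i₀} → K)}
    {CL : (Fin 4 × Fin 4 → K) →ₗ[K] Matrix {i // i ≠ i₀} {i // i ≠ i₀} K} {κ : K}
    (hD : IsUnit D.det) (hDs : Dᵀ = D) (hCs : ∀ z, (CL z)ᵀ = CL z) (hκ : κ ≠ 0)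
    (hi : ∀ z, bL z ⬝ᵥ D⁻¹ *ᵥ bL z = 0)
    (hii : ∀ z, bL z ⬝ᵥ (D⁻¹ * CL z * D⁻¹) *ᵥ bL z = 0)
    (hiii : ∀ z, D.det * (bL z ⬝ᵥ (D⁻¹ * CL z * D⁻¹ * CL z * D⁻¹) *ᵥ bL z) =
      -(κ * eval z (perPoly (Fin 4) K)))
    (hV4 : ∀ x ∈ LinearMap.ker bL, ∀ r c : Fin 4,
      ((Matrix.of fun i j => x (i, j)).submatrix r.succAbove c.succAbove).permanent = 0)
    (hcard : Fintype.card {i // i ≠ i₀} + 1 = m)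
    (hrn : finrank K (LinearMap.range bL) + finrank K (LinearMap.ker bL) = 16)
    (h9 : finrank K (LinearMap.range bL) = 9) : False :=
  false_of_rank_nine_le_twentySeven_of_IR9H K (IR9H_of_IR9U IR9U) hm hD hDs hCs hκ hi hii hiii
    hV4 hcard hrn h9

end Summit.ValiantsHypothesis.ValiantsHypothesis.Theorems.SymPencilPerFourInnerRankNineHyperplane

end
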